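import Summits.QuantumAdvantage.QuantumAdvantage.Theorems.CylinderDialPieces

/-!
# CylinderDial, part 3/4: g8's located core is CYLINDER-TAME (support for item stmt-QuantumAdvantage-30910)

Land port of §5–§6 of the node «CylinderDial» (cell decomp-qadv, lens-5, g13).  `nandRing_cylTame_clause`: the single `δ₀`-ring
whose win event is `NAND` of `r` long block parities (tree `TameDial.exists_nand_ring`, the witnesses of
`spreadDial_noAlgebraicShadow3` = «no inner algebraic core at F = ∅») satisfies the cylinder-tameness clause with ONE FROZEN
BLOCK: freeze `F = T_{j₀}`; the canonical words of even parity on `T_{j₀}` have their whole cylinder inside the event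
(`tame_clause_of_interior`, test `ψ = 1`, leak 0) and cover `2^{n-1}` inputs (tree `TameDial.card_parity_classes`).
No `sorry`, no new axioms, no instances, no notation.
-/

set_option linter.style.longLine false
set_option linter.dupNamespace false

noncomputable section
open scoped Classical

namespace Summit.QuantumAdvantage.QuantumAdvantage.Theorems.CylinderDial

open Finset
open Literature.Computability.QuantumComplexity Literature.Computability.QuantumComplexity.RingHLF
open Literature.Computability.MetaComplexity
open Summit.QuantumAdvantage.AdviceFreeQNC0
open Summit.QuantumAdvantage.QuantumAdvantage.Theses

/-! ## §5  The interior sub-law (pure cylinders suffice when the event CONTAINS many whole cylinders) -/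

section Interior
variable {n : ℕ}

/-- If a cylinder lies INSIDE the event, the constant test `ψ = 1` is an exact inner core on it (density 1, leak 0):
the tameness clause of `CylTame3` holds on that cylinder for every `η' ≤ 1`, every `i` and every degree budget. -/
theorem tame_clause_of_interior {m : ℕ} (w : Fin m → Fin n → Bool) (Q : Fin m → Fin n → Smolensky.CubeFn (ZMod 3) n)
    (F : Finset (Fin n)) (a : Fin n → Bool) (D i : ℕ) {η' : ℝ} (hη' : 0 ≤ η')
    (hin : ∀ y ∈ cyl F a, ∀ t, RingHLF.Rel (w t) (fun b => decide (Q t b y = 1))) :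
    ∃ ψ : Smolensky.CubeFn (ZMod 3) n, ψ ∈ Smolensky.lowDeg (ZMod 3) n D ∧
      (1 - η') * ((cyl F a).card : ℝ) ≤ (((cyl F a).filter fun y => ψ y = 1).card : ℝ) ∧
      (((cyl F a).filter fun y => ψ y = 1 ∧
          ¬ (∀ t, RingHLF.Rel (w t) (fun b => decide (Q t b y = 1)))).card : ℝ) ≤
        1 / (n : ℝ) ^ i * ((cyl F a).card : ℝ) := by
  refine ⟨1, ?_, ?_, ?_⟩
  · have := Smolensky.mono_mem_lowDeg (F := ZMod 3) (n := n) (S := ∅) (D := D) (by simp)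
    simpa using this
  · have hfull : ((cyl F a).filter fun y : Fin n → Bool => (1 : Smolensky.CubeFn (ZMod 3) n) y = 1) = cyl F a := by
      apply Finset.filter_true_of_mem; intro y _; rfl
    rw [hfull]; nlinarith [Nat.cast_nonneg (α := ℝ) (cyl F a).card]
  · have hempty : ((cyl F a).filter fun y : Fin n → Bool => (1 : Smolensky.CubeFn (ZMod 3) n) y = 1 ∧
        ¬ (∀ t, RingHLF.Rel (w t) (fun b => decide (Q t b y = 1)))) = ∅ := by
      apply Finset.filter_false_of_mem; intro y hy h; exact h.2 (hin y hy)
    rw [hempty, Finset.card_empty]; push_cast; positivity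

end Interior

/-! ## §6  The located core is cylinder-tame (PROVED): g8's NAND-of-long-block-parities rings -/

section Nand
variable {n : ℕ}

/-- the canonical frozen word of `y` on `F` (copy `y` on `F`, `false` elsewhere). -/
def canon (F : Finset (Fin n)) (y : Fin n → Bool) : Fin n → Bool := fun i => if i ∈ F then y i else false

/-- CylinderDialNand helper `canon_off` (decomp-qadv land package; see the module docstring). -/
theorem canon_off {F : Finset (Fin n)} {y : Fin n → Bool} {i : Fin n} (hi : i ∉ F) : canon F y i = false := by
  simp [canon, hi]

/-- CylinderDialNand helper `mem_cyl_canon` (decomp-qadv land package; see the module docstring). -/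
theorem mem_cyl_canon (F : Finset (Fin n)) (y : Fin n → Bool) : y ∈ cyl F (canon F y) := by
  rw [mem_cyl]; intro i hi; simp [canon, hi]

/-- the number of ones on `F` is constant on each cylinder over `F`. -/
theorem pc_eq_of_mem_cyl {F : Finset (Fin n)} {a y : Fin n → Bool} (hy : y ∈ cyl F a) :
    Theorems.TameDial.pc F y = Theorems.TameDial.pc F a := by
  unfold Theorems.TameDial.pc
  rw [Finset.filter_congr (fun i hi => by rw [(mem_cyl.1 hy) i hi])]

/-- ★ **NAND RINGS ARE CYLINDER-TAME.**  Let a single foreign ring have win event `NAND(ℓ_{T_1},…,ℓ_{T_r})`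
(`ℓ_j(y) = ⊕_{b ∈ T_j} y_b`; these are exactly g8's rough witnesses, tree `Theorems.TameDial.exists_nand_ring`, behind
`Theorems.spreadDial_noAlgebraicShadow3`).  If some block `T_{j₀}` is non-empty with `2|T_{j₀}| ≤ n`, then the clause of
`CylTame3` holds for this system with `F = T_{j₀}`, the good words = canonical words of EVEN parity on `T_{j₀}` (their
cylinders cover `2^{n-1} ≥ 2ⁿ/n^j` inputs), and the exact inner core `ψ = 1` on each (density `1`, leak `0`) — for every
target density, every leak exponent and every degree budget.  FREEZING ONE BLOCK dissolves the two-moduli obstruction that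
no GLOBAL algebraic shadow can (g8). -/
theorem nand_cylTame_clause {r : ℕ} (T : Fin r → Finset (Fin n)) (j₀ : Fin r) (hT : (T j₀).Nonempty)
    (hF : 2 * (T j₀).card ≤ n) (hn : 2 ≤ n) {m : ℕ} (w : Fin m → Fin n → Bool)
    (Q : Fin m → Fin n → Smolensky.CubeFn (ZMod 3) n)
    (hwin : ∀ y, (∀ t, RingHLF.Rel (w t) (fun i => decide (Q t i y = 1))) ↔
      ¬ ∀ j, Theorems.TameDial.pc (T j) y % 2 = 1)
    (D i j : ℕ) (hj : 1 ≤ j) {η' : ℝ} (hη' : 0 ≤ η') :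
    ∃ F : Finset (Fin n), 2 * F.card ≤ n ∧ ∃ A : Finset (Fin n → Bool),
      (∀ a ∈ A, ∀ i, i ∉ F → a i = false) ∧
      1 / (n : ℝ) ^ j * (2 : ℝ) ^ n ≤ ((A.biUnion (cyl F)).card : ℝ) ∧
      ∀ a ∈ A, ∃ ψ : Smolensky.CubeFn (ZMod 3) n,
        ψ ∈ Smolensky.lowDeg (ZMod 3) n D ∧
        (1 - η') * ((cyl F a).card : ℝ) ≤ (((cyl F a).filter fun y => ψ y = 1).card : ℝ) ∧
        (((cyl F a).filter fun y => ψ y = 1 ∧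
            ¬ (∀ t, RingHLF.Rel (w t) (fun b => decide (Q t b y = 1)))).card : ℝ) ≤
          1 / (n : ℝ) ^ i * ((cyl F a).card : ℝ) := by
  classical
  set F := T j₀ with hFdef
  set A : Finset (Fin n → Bool) :=
    univ.filter fun a => (∀ b, b ∉ F → a b = false) ∧ Theorems.TameDial.pc F a % 2 = 0 with hAdef
  refine ⟨F, hF, A, fun a ha => ((Finset.mem_filter.1 ha).2).1, ?_, ?_⟩
  · -- the good cylinders cover the even-parity class of `F`, which has `2^(n-1)` elements
    have hcover : (univ.filter fun y : Fin n → Bool => Theorems.TameDial.pc F y % 2 = 0) ⊆ A.biUnion (cyl F) := by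
      intro y hy
      rw [Finset.mem_filter] at hy
      rw [Finset.mem_biUnion]
      refine ⟨canon F y, ?_, mem_cyl_canon F y⟩
      rw [hAdef, Finset.mem_filter]
      refine ⟨Finset.mem_univ _, fun b hb => canon_off hb, ?_⟩
      rw [← pc_eq_of_mem_cyl (mem_cyl_canon F y)]; exact hy.2
    have hhalf := (Theorems.TameDial.card_parity_classes F hT).1
    have hle : (2 : ℝ) ^ (n - 1) ≤ ((A.biUnion (cyl F)).card : ℝ) := by
      have := Finset.card_le_card hcover
      rw [hhalf] at this
      exact_mod_cast this
    refine le_trans ?_ hle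
    have hn1 : (n : ℝ) ^ j ≥ 2 := by
      have h2n : (2 : ℝ) ≤ n := by exact_mod_cast hn
      calc (n : ℝ) ^ j ≥ (n : ℝ) ^ 1 := pow_le_pow_right₀ (by linarith) hj
        _ = n := pow_one _
        _ ≥ 2 := h2n
    have hpow : (2 : ℝ) ^ n = 2 * (2 : ℝ) ^ (n - 1) := by
      rw [← pow_succ']; congr 1; omega
    rw [hpow]
    rw [div_mul_eq_mul_div, one_mul, div_le_iff₀ (by positivity)]
    nlinarith [pow_nonneg (show (0:ℝ) ≤ 2 by norm_num) (n - 1)]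
  · -- on a good cylinder the block parity `ℓ_{j₀}` is even, so every input wins: interior, `ψ = 1`
    intro a ha
    have ha2 := ((Finset.mem_filter.1 ha).2).2
    refine tame_clause_of_interior w Q F a D i hη' (fun y hy => ?_)
    rw [hwin]
    intro hall
    have := hall j₀
    rw [← hFdef, pc_eq_of_mem_cyl hy, ha2] at this
    exact absurd this (by norm_num)

/-- **g8's certified NAND ring (tree `Theorems.TameDial.exists_nand_ring`, length `n = 8t`, pattern `δ₀`, blocks with
`∏ |T_j| ≤ 4t`, all non-empty) satisfies the clause of `CylTame3`** — the explicit rough witnesses of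
`spreadDial_noAlgebraicShadow3` lie INSIDE the cylinder law's tame class. -/
theorem nandRing_cylTame_clause {t : ℕ} (ht : 1 ≤ t) {r : ℕ} (hr : 1 ≤ r)
    (T : Fin r → Finset (Fin (8 * t))) (hne : ∀ j, (T j).Nonempty) (hM : (∏ j, (T j).card) ≤ 4 * t)
    (D i j : ℕ) (hj : 1 ≤ j) {η' : ℝ} (hη' : 0 ≤ η') :
    ∃ Q : Fin (8 * t) → Smolensky.CubeFn (ZMod 3) (8 * t),
      (∀ b, Q b ∈ Smolensky.lowDeg (ZMod 3) (8 * t) r) ∧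
      (∀ y, RingHLF.Rel (Theorems.delta0 t) (fun b => decide (Q b y = 1)) ↔
        ¬ ∀ j, Theorems.TameDial.pc (T j) y % 2 = 1) ∧
      ∃ F : Finset (Fin (8 * t)), 2 * F.card ≤ 8 * t ∧ ∃ A : Finset (Fin (8 * t) → Bool),
        (∀ a ∈ A, ∀ i, i ∉ F → a i = false) ∧
        1 / ((8 * t : ℕ) : ℝ) ^ j * (2 : ℝ) ^ (8 * t) ≤ ((A.biUnion (cyl F)).card : ℝ) ∧
        ∀ a ∈ A, ∃ ψ : Smolensky.CubeFn (ZMod 3) (8 * t),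
          ψ ∈ Smolensky.lowDeg (ZMod 3) (8 * t) D ∧
          (1 - η') * ((cyl F a).card : ℝ) ≤ (((cyl F a).filter fun y => ψ y = 1).card : ℝ) ∧
          (((cyl F a).filter fun y => ψ y = 1 ∧
              ¬ (∀ _ : Fin 1, RingHLF.Rel (Theorems.delta0 t) (fun b => decide (Q b y = 1)))).card : ℝ) ≤
            1 / ((8 * t : ℕ) : ℝ) ^ i * ((cyl F a).card : ℝ) := by
  classical
  obtain ⟨Q, hQdeg, hQwin⟩ := Theorems.TameDial.exists_nand_ring ht T hM
  refine ⟨Q, hQdeg, hQwin, ?_⟩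
  let j₀ : Fin r := ⟨0, hr⟩
  have hprodpos : 0 < ∏ j, (T j).card := Finset.prod_pos fun j _ => Finset.card_pos.mpr (hne j)
  have hcard : (T j₀).card ≤ 4 * t :=
    le_trans (Nat.le_of_dvd hprodpos (Finset.dvd_prod_of_mem _ (Finset.mem_univ j₀))) hM
  have h := nand_cylTame_clause (n := 8 * t) T j₀ (hne j₀) (by omega) (by omega)
    (fun _ : Fin 1 => Theorems.delta0 t) (fun _ : Fin 1 => Q)
    (fun y => Iff.trans ⟨fun h => h 0, fun h _ => h⟩ (hQwin y)) D i j hj hη'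
  simpa using h

end Nand


end Summit.QuantumAdvantage.QuantumAdvantage.Theorems.CylinderDial
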